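import Literature.Probability.RandomPlanarGeometry.SAWKestenRenewalMeasure
import Literature.Probability.RandomPlanarGeometry.SAWTubeConnectors
import HarnessLib

/-!
# Kesten's infinite bridge goes straight with probability at least `μ^{1-m}` (lane «pcv-sawmu», route R45 «INF-BRIDGE», negative side)

Topic `Literature/Probability/RandomPlanarGeometry` (continues `SAWKestenBridgeMeasure.lean` / `SAWKestenRenewalMeasure.lean`: Kesten's
cylinder weights `Zd.kestenCyl d m ω = Σ_k |E_k(ω)| μ^{-k}` of Madras–Slade (8.3.4)/(8.3.6), `Zd.eCount`; `SAWKestenRelation.lean`: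
Kesten's relation `Σ_k λ_k μ^{-k} = 1`).

Source: N. Madras, G. Slade, *The Self-Avoiding Walk* (1993), §8.3 (Theorem 8.3.1, eqs. (8.3.4)–(8.3.6)) and §4.2 (eq. (4.2.4)). The
statement proved is the lane's (a-ref-1 g17/g18 refute-first census of route R45, a-p6's criterion `M_1 = μ`): for the STRAIGHT prefix
`E^m = (0, e₀, 2e₀, …, m e₀)`,
  `P^B_∞(ζ[0,m] = E^m) = kestenCyl d m E^m ≥ μ^{1-m}`   (`m ≥ 1`, every `d`),
because every bridge `E^{m-1} ∘ η` with `η` an irreducible bridge of length `k-m+1` extends `E^m` (an irreducible bridge starts with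
`+e₀`) and has no renewal time in `[m, k)`, so `|E_k(E^m)| ≥ λ_{k-m+1}` and `Σ_k |E_k| μ^{-k} ≥ μ^{1-m} Σ_ℓ λ_ℓ μ^{-ℓ} = μ^{1-m}`.
Consequence (`not_irrPrefixPoly_of_lt`, in the companion file once `SAWKestenTransfer.lean` is in the tree): the lane's crux
`IrrPrefixPoly C a` (`kestenCyl ≤ C m^a μ^{-m}`) is false for `a = 0`, `C < μ`, and for every `a < 0`.

## Contents (namespace `Literature.Probability.RandomPlanarGeometry.SAW.Zd`)
* `bridge_apply_one` — a bridge of length `≥ 1` starts with the step `+e₀`;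
* `concat_straight_mem_eCountSet` — `E^{m-1} ∘ η ∈ E_k(E^m)` for `η ∈ Λ_{k-m+1}`;
* `irreducibleBridgeCount_le_eCount_straight` — `λ_{k-m+1} ≤ |E_k(E^m)|` (`1 ≤ m ≤ k`);
* **`kestenCyl_straightWalk_ge`** — `μ^{1-m} ≤ kestenCyl d m (straightWalk d m)` (`1 ≤ m`).
Tree-twin search: stems `kestenCyl_straight`, `eCount_straight`, `apply_one.*single` → none. No twin.
-/

noncomputable section

open Finset Filter Topology Literature.Probability.LatticeModels Literature.Probability.Percolation
open scoped BigOperators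

namespace Literature.Probability.RandomPlanarGeometry.SAW.Zd

variable {d : ℕ} [NeZero d]

/-- **A bridge of positive length starts with the step `+e₀`** (its height must rise at time `1`).
[cite: MadrasSlade1993, Definition 1.2.4 (bridges), §1.2] -/
theorem bridge_apply_one {n : ℕ} {β : ℕ → Site d} (hβ : β ∈ bridges d n) (hn : 1 ≤ n) : β 1 = Pi.single 0 1 := by
  obtain ⟨hs, hbr⟩ := mem_bridges.1 hβ
  obtain ⟨h0, -, hadj, -⟩ := mem_saws.1 hs
  have hup : β 0 0 < β 1 0 := (hbr 1 le_rfl hn).1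
  have ha := hadj 0 (by omega)
  rw [zero_add, zdGraph_adj_iff_sub, h0] at ha
  obtain ⟨c, hc | hc⟩ := ha
  · rw [sub_zero] at hc
    rw [h0, hc] at hup
    simp only [Pi.zero_apply, Pi.single_apply] at hup
    split_ifs at hup with h
    · rw [hc, ← h]
    · exact absurd hup (lt_irrefl 0)
  · rw [zero_sub, neg_eq_iff_eq_neg] at hc
    rw [h0, hc] at hup
    simp only [Pi.zero_apply, Pi.neg_apply, Pi.single_apply] at hup
    split_ifs at hup <;> norm_num at hup

/-- Heights of the straight walk. [cite: MadrasSlade1993, §1.2 (the straight walk)] -/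
theorem straightWalk_apply_of_le {n i : ℕ} (hi : i ≤ n) : straightWalk d n i = Pi.single 0 (i : ℤ) := by
  simp [straightWalk, min_eq_left hi]

/-- **The witnesses**: for `η` an irreducible bridge of length `k - (m-1) ≥ 1`, the bridge `E^{m-1} ∘ η` extends `E^m` and has no
renewal time in `[m, k)` — it lies in `E_k(E^m)`. [cite: MadrasSlade1993, Theorem 8.3.1 (the sets E_k(ω)), §4.2 (irreducible bridges)] -/
theorem concat_straight_mem_eCountSet {m k : ℕ} (hm : 1 ≤ m) (hmk : m ≤ k) {η : ℕ → Site d}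
    (hη : η ∈ irreducibleBridges d (k - (m - 1))) :
    concatWalk (m - 1) (straightWalk d (m - 1)) η ∈ bridges d k ∧
      (∀ j, j ≤ m → concatWalk (m - 1) (straightWalk d (m - 1)) η j = straightWalk d m j) ∧
      ∀ i, m ≤ i → i < k → ¬ IsRenewalTime k (concatWalk (m - 1) (straightWalk d (m - 1)) η) i := by
  set s := m - 1 with hs
  set β := concatWalk s (straightWalk d s) η with hβ
  obtain ⟨hηb, hirr⟩ := mem_irreducibleBridges.1 hη
  obtain ⟨hηs, hηbr⟩ := mem_bridges.1 hηb
  have hη0 : η 0 = 0 := (mem_saws.1 hηs).1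
  have hβb : β ∈ bridges d k := concatWalk_mem_bridges (by omega) (straightWalk_mem_bridges s) hηb
  refine ⟨hβb, fun j hj => ?_, fun i hmi hik hren => ?_⟩
  · rcases Nat.lt_or_ge j m with hjm | hjm
    · rw [hβ, concatWalk_apply_of_le _ _ (show j ≤ s by omega), straightWalk_apply_of_le (show j ≤ s by omega),
        straightWalk_apply_of_le hj]
    · have hjm' : j = s + 1 := by omega
      rw [hjm', hβ, concatWalk_apply_add _ _ hη0, bridge_apply_one hηb (by omega),
        straightWalk_apply_of_le le_rfl, straightWalk_apply_of_le (by omega), ← Pi.single_add]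
      push_cast
      rfl
  · -- a renewal time `i ∈ (s, k)` of `β` would be a renewal time `i - s ∈ [1, ℓ-1]` of `η`
    obtain ⟨-, hbi, hbki⟩ := hren
    have hval : ∀ j, β (s + j) = straightWalk d s s + η j := fun j => by rw [hβ, concatWalk_apply_add _ _ hη0]
    have hhs : ∀ j, β (s + j) 0 = (s : ℤ) + η j 0 := fun j => by
      rw [hval, Pi.add_apply, straightWalk_apply_of_le le_rfl, Pi.single_eq_same]
    apply hirr.2.2 (i - s) (by omega) (by omega)
    refine ⟨by omega, fun j hj1 hj2 => ?_, fun j hj1 hj2 => ?_⟩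
    · -- `η` is a bridge on `[0, i - s]`: heights from `β` being a bridge on `[0, i]`
      have h1 := (hηbr j hj1 (by omega)).1
      have h2 := (hbi (s + j) (by omega) (by omega)).2
      rw [show i = s + (i - s) by omega, hhs, hhs] at h2
      exact ⟨h1, by linarith⟩
    · -- the tail of `η` after `i - s` is the tail of `β` after `i`, shifted by `s e₀`
      have h := hbki j hj1 (by omega)
      simp only at h
      rw [show i + j = s + (i - s + j) by omega, show i + 0 = s + (i - s + 0) by omega,
        show i + (k - i) = s + (i - s + (k - i)) by omega, hhs, hhs, hhs] at h
      rw [show k - (m - 1) - (i - s) = k - i by omega]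
      constructor <;> linarith [h.1, h.2]

open Classical in
/-- **`λ_{k-m+1} ≤ |E_k(E^m)|`** for `1 ≤ m ≤ k`. [cite: MadrasSlade1993, Theorem 8.3.1 (the sets E_k(ω))] -/
theorem irreducibleBridgeCount_le_eCount_straight {m k : ℕ} (hm : 1 ≤ m) (hmk : m ≤ k) :
    irreducibleBridgeCount d (k - (m - 1)) ≤ eCount d k m (straightWalk d m) := by
  unfold irreducibleBridgeCount eCount
  refine Finset.card_le_card_of_injOn (fun η => concatWalk (m - 1) (straightWalk d (m - 1)) η) (fun η hη => ?_)
    (fun η hη η' hη' h => ?_)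
  · rw [Finset.mem_coe] at hη
    obtain ⟨h1, h2, h3⟩ := concat_straight_mem_eCountSet hm hmk hη
    rw [Finset.mem_coe, Finset.mem_filter]
    exact ⟨h1, h2, h3⟩
  · rw [Finset.mem_coe] at hη hη'
    exact (concatWalk_injective_pieces (straightWalk_mem_saws d (m - 1))
      (mem_bridges.1 (irreducibleBridges_subset_bridges _ hη)).1 (straightWalk_mem_saws d (m - 1))
      (mem_bridges.1 (irreducibleBridges_subset_bridges _ hη')).1 h).2

/-- **Kesten's infinite bridge goes straight for `m` steps with probability at least `μ^{1-m}`**: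
`μ^{1-m} ≤ kestenCyl d m (straightWalk d m)` for `m ≥ 1` (so the lane's crux `IrrPrefixPoly C a` needs `a ≥ 0` and, at `a = 0`,
`C ≥ μ`). [cite: MadrasSlade1993, §8.3, Theorem 8.3.1 and eq. (8.3.6); §4.2, eq. (4.2.4) (quantitative consequence, this file)] -/
theorem kestenCyl_straightWalk_ge {m : ℕ} (hm : 1 ≤ m) :
    connectiveConstant d / connectiveConstant d ^ m ≤ kestenCyl d m (straightWalk d m) := by
  have hμ := connectiveConstant_pos d
  set e : ℕ → ℝ := fun k => (eCount d k m (straightWalk d m) : ℝ) / connectiveConstant d ^ k with he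
  have hsum : Summable e := summable_eCount_div_pow (straightWalk_mem_saws d m)
  have he0 : ∀ k, 0 ≤ e k := fun k => by positivity
  rw [kestenCyl_eq_tsum_div]
  -- drop the (vanishing) terms `k < m - 1 + 0`, reindex `k = (m - 1) + ℓ`
  have hsplit := hsum.sum_add_tsum_nat_add (m - 1)
  have hhead : 0 ≤ ∑ i ∈ Finset.range (m - 1), e i := Finset.sum_nonneg fun i _ => he0 i
  -- Kesten's relation, shifted: `Σ_ℓ λ_ℓ μ^{-ℓ} = 1`
  have hK : HasSum (fun ℓ : ℕ => (irreducibleBridgeCount d ℓ : ℝ) / connectiveConstant d ^ ℓ) 1 :=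
    MadrasSlade1993_eq424_holds d
  -- termwise: `λ_ℓ μ^{-ℓ} · μ^{1-m} ≤ e ((m-1) + ℓ)`
  have hterm : ∀ ℓ : ℕ, (irreducibleBridgeCount d ℓ : ℝ) / connectiveConstant d ^ ℓ *
      (connectiveConstant d / connectiveConstant d ^ m) ≤ e (ℓ + (m - 1)) := by
    intro ℓ
    rcases Nat.eq_zero_or_pos ℓ with rfl | hℓ
    · simp [he0]
    · have hle := irreducibleBridgeCount_le_eCount_straight (d := d) hm (show m ≤ ℓ + (m - 1) by omega)
      rw [show ℓ + (m - 1) - (m - 1) = ℓ by omega] at hle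
      have hle' : (irreducibleBridgeCount d ℓ : ℝ) ≤ eCount d (ℓ + (m - 1)) m (straightWalk d m) := by exact_mod_cast hle
      have hpow : connectiveConstant d ^ ℓ * connectiveConstant d ^ m =
          connectiveConstant d ^ (ℓ + (m - 1)) * connectiveConstant d := by
        rw [← pow_succ, ← pow_add]; congr 1; omega
      have heq : (irreducibleBridgeCount d ℓ : ℝ) / connectiveConstant d ^ ℓ * (connectiveConstant d / connectiveConstant d ^ m) =
          (irreducibleBridgeCount d ℓ : ℝ) / connectiveConstant d ^ (ℓ + (m - 1)) := by
        rw [div_mul_div_comm, hpow, mul_div_mul_right _ _ hμ.ne']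
      rw [heq]
      exact div_le_div_of_nonneg_right hle' (pow_nonneg hμ.le _)
  have hmul : HasSum (fun ℓ : ℕ => (irreducibleBridgeCount d ℓ : ℝ) / connectiveConstant d ^ ℓ *
      (connectiveConstant d / connectiveConstant d ^ m)) (1 * (connectiveConstant d / connectiveConstant d ^ m)) :=
    hK.mul_right _
  have htail : Summable fun ℓ => e (ℓ + (m - 1)) := (summable_nat_add_iff (m - 1)).2 hsum
  have hcmp := hasSum_le hterm hmul htail.hasSum
  rw [one_mul] at hcmp
  linarith [hsplit.symm.le, hcmp, hhead]

end Literature.Probability.RandomPlanarGeometry.SAW.Zd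

end
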